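import Literature.Computability.Complexity.KSATReductions
import Literature.Computability.FineGrained.FineGrainedWave0
import HarnessLib

/-!
# SERF reduction of `k`-SAT (parameter `n`) to `k`-SAT (parameter `m`), I: the Boolean front end

Family `fine-grained`. First file of the machine behind
`Literature.Computability.FineGrained.serfReducible_kSATParam_kSATClauseParam` (Impagliazzo–Paturi–Zane,
JCSS 63 (2001), §2, Cor. 1–2: sparsification gives a SERF reduction from `k`-SAT with parameter
`n` to `k`-SAT with parameter `m`). The oracle machine of that reduction receives a `{0,1}`-string
`x` (a candidate code of a CNF in `encodingCNF`) and must hand a `Γ'`-coded `KCNF k`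
(`KCNF.encode`, the input convention of the sparsifier `sparsification_holds` and of the compaction
machine `kCNF_compact_computable_holds`) to the `Γ'` side. This file is the polynomial-time
`{0,1}`-side of that hand-over, assembled from the tree's `FP` bricks (no machine is written):

* `SerfKSat.swLit` — the literal encoding with the POLARITY FIRST, `(v, b) ↦ ⟨[b], ⌜v⌝⟩` (so that a
  finite-state transducer can later emit `KCNF.encodeLiteral (v, b) = bit b, ⌜v⌝, comma` in reading
  order), and `SerfKSat.swCodeFn` — the re-encoding of a CNF code with swapped literals
  (`canonListFnC` twice, `swCodeFn_eq`);
* `SerfKSat.hdrFn x = ⌜2 ^ (|x| + 1)⌝` (`Ladder3.freshFn`), a numeral above every variable a string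
  of length `|x|` denotes (`Ladder3.decCNF_vars_lt`), used as the `numVars` header;
* `SerfKSat.Good k x` — `x` is the code of a `k`-CNF — and `SerfKSat.kcnfOf k x : KCNF k`, the
  formula handed over (`⟨2^{|x|+1}, decCNF x⟩` if good, the empty formula on `0` variables otherwise);
* `SerfKSat.preFn k` — **the front end**: `x ↦ ⟨[good], ⟨⌜numVars⌝, swapped code of the clauses⟩⟩`
  (`preFn_eq`), in `FP` (`preFn_mem_FP`).

## References

* R. Impagliazzo, R. Paturi, F. Zane, *Which problems have strongly exponential complexity?*,
  J. Comput. System Sci. 63 (2001) 512–530, §2 (SERF reductions), Cor. 1–2.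
* S. Arora, B. Barak, *Computational Complexity: A Modern Approach*, CUP 2009, §0.1 (codes of
  pairs and lists), §1.3 (polynomial time is closed under composition).
-/

noncomputable section

namespace Literature.Computability.FineGrained.SerfKSat

open _root_.Computability Complexity Complexity.Brick Complexity.CanonCode Complexity.NegCNF
  Complexity.KSATRed

/-! ### Literals with the polarity first -/

/-- The swapped literal encoding: `(v, b) ↦ ⟨[b], ⌜v⌝⟩` (polarity, then the binary numeral of the
variable). [cite: AroraBarakCC2009, §0.1] -/
def swLit : Encoding (Literal ℕ) Bool where
  encode l := boolPair (encodeBool l.2) (encodeNat l.1)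
  decode w := some (decodeNat (boolUnpair w).2, decodeBool (boolUnpair w).1)
  decode_encode l := by
    rcases l with ⟨v, b⟩
    simp [boolUnpair_boolPair, decode_encodeNat]

/-- The swapped literal code of `(v, b)` (definitional). [folklore] -/
theorem swLit_encode (l : Literal ℕ) : swLit.encode l = boolPair [l.2] (encodeNat l.1) := rfl

/-- The item map producing swapped literal codes from literal codes:
`u ↦ ⟨[head (snd u)], canonical numeral of fst u⟩`. [folklore] -/
def ciLit : List Bool → List Bool := fanoutFn (HashBricks.headBitFn ∘ sndF) (canonF ∘ fstF)

/-- `ciLit ∈ FP`. [cite: AroraBarakCC2009, §1.3] -/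
theorem ciLit_mem_FP : ciLit ∈ FP :=
  fanoutFn_mem_FP (comp_mem_FP HashBricks.headBitFn_mem_FP sndF_mem_FP) (comp_mem_FP canonF_mem_FP fstF_mem_FP)

/-- `ciLit` is the swapped re-encoding of the decoded literal. [folklore] -/
theorem ciLit_eq (u : List Bool) : ciLit u = swLit.encode (decLit u) := by
  rw [ciLit, fanoutFn_apply, Function.comp_apply, Function.comp_apply,
    headBitFn_eq_encodeBool_decodeBool, canonF_eq_encodeNat_decodeNat]
  rfl

/-- `|ciLit u| ≤ |u| + 5`. [folklore] -/
theorem length_ciLit_le (u : List Bool) : (ciLit u).length ≤ 1 * u.length + 5 := by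
  rw [ciLit, fanoutFn_apply, length_boolPair, Function.comp_apply, Function.comp_apply,
    HashBricks.headBitFn_apply]
  have h1 := length_canonF_le (fstF u)
  have h2 := length_fstF_sndF_le u
  simp only [List.length_singleton]
  omega

/-- Swapped clause codes: `swLit.listBool`-codes from clause codes (clipped list loop, clip `6`).
[cite: AroraBarakCC2009, §0.1] -/
def swClauseFn : List Bool → List Bool := canonListFnC 6 ciLit

/-- `swClauseFn ∈ FP`. [cite: AroraBarakCC2009, §1.3] -/
theorem swClauseFn_mem_FP : swClauseFn ∈ FP := canonListFnC_mem_FP 6 ciLit_mem_FP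

/-- `swClauseFn u` is the swapped code of the decoded clause. [folklore] -/
theorem swClauseFn_eq (u : List Bool) : swClauseFn u = swLit.listBool.encode (decClause u) := by
  rw [swClauseFn, canonListFnC_apply length_ciLit_le (by norm_num)]
  simp only [Encoding.listBool, decClause, length_decList, foldr_decList swLit decLit ciLit_eq]

/-- `|swClauseFn u| ≤ 8 |u| + 2`. [folklore] -/
theorem length_swClauseFn_le (u : List Bool) : (swClauseFn u).length ≤ 8 * u.length + 2 := by
  have h := length_canonListFnC_le (C := 6) length_ciLit_le (by norm_num) u
  rw [swClauseFn]; omega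

/-- **Swapped CNF codes**: the code of the decoded CNF in `swLit.listBool.listBool`.
[cite: AroraBarakCC2009, §0.1] -/
def swCodeFn : List Bool → List Bool := canonListFnC 10 swClauseFn

/-- `swCodeFn ∈ FP`. [cite: AroraBarakCC2009, §1.3] -/
theorem swCodeFn_mem_FP : swCodeFn ∈ FP := canonListFnC_mem_FP 10 swClauseFn_mem_FP

/-- `swCodeFn w` is the swapped code of `decCNF w`. [folklore] -/
theorem swCodeFn_eq (w : List Bool) : swCodeFn w = swLit.listBool.listBool.encode (decCNF w) := by
  rw [swCodeFn, canonListFnC_apply length_swClauseFn_le (by norm_num),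
    ← foldr_decList swLit.listBool decClause swClauseFn_eq]
  show _ = boolPair (unaryEncodeNat (decCNF w).length)
    ((decCNF w).foldr (fun a acc => boolPair (swLit.listBool.encode a) acc) [])
  rw [show decCNF w = decList decClause (boolUnpair w).1.length (boolUnpair w).2 from rfl, length_decList]

/-! ### The header numeral -/

/-- The header map `x ↦ ⌜2 ^ (|x| + 1)⌝` (`Ladder3.freshFn ⟨x, ⌜0⌝⟩`). [folklore] -/
def hdrFn : List Bool → List Bool := Ladder3.freshFn ∘ fanoutFn id fun _ => []

/-- `hdrFn ∈ FP`. [cite: AroraBarakCC2009, §1.3] -/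
theorem hdrFn_mem_FP : hdrFn ∈ FP :=
  comp_mem_FP Ladder3.freshFn_mem_FP (fanoutFn_mem_FP OracleCompose.id_mem_FP (const_mem_FP _))

/-- `hdrFn x = ⌜2 ^ (|x| + 1)⌝`. [folklore] -/
theorem hdrFn_apply (x : List Bool) : hdrFn x = encodeNat (2 ^ (x.length + 1)) := by
  rw [hdrFn, Function.comp_apply, fanoutFn_apply]
  have h := Ladder3.freshFn_encodeNat (w := x) (t := 0) (by simp [encodeNat, encodeNum])
  simpa [encodeNat, encodeNum] using h

/-- The header numeral is `0^{|x|+1} 1`. [folklore] -/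
theorem hdrFn_eq_replicate (x : List Bool) : hdrFn x = List.replicate (x.length + 1) false ++ [true] := by
  rw [hdrFn, Function.comp_apply, fanoutFn_apply, Ladder3.freshFn_boolPair]
  simp

/-! ### Good inputs and the formula handed over -/

/-- `Good k x`: `x` is the (canonical) code of a CNF all of whose clauses have at most `k` literals,
i.e. `x ∈ kSAT k` up to satisfiability. [cite: AroraBarakCC2009, Def. 2.9] -/
def Good (k : ℕ) (x : List Bool) : Prop := encodingCNF.encode (decCNF x) = x ∧ CNF.IsWidthLE k (decCNF x)

/-- Goodness is decidable (a syntactic test). [folklore] -/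
instance (k : ℕ) (x : List Bool) : Decidable (Good k x) := inferInstanceAs (Decidable (_ ∧ _))

/-- A member of `kSAT k` is good. [folklore] -/
theorem good_of_mem_kSAT {k : ℕ} {x : List Bool} (h : x ∈ kSAT k) : Good k x := by
  obtain ⟨φ, hφ, rfl⟩ := h
  exact ⟨by rw [decCNF_encode], by rw [decCNF_encode]; exact hφ.1⟩

/-- Membership in `kSAT k` of a good string is satisfiability of the decoded CNF. [folklore] -/
theorem mem_kSAT_iff_of_good {k : ℕ} {x : List Bool} (h : Good k x) :
    x ∈ kSAT k ↔ (decCNF x).Satisfiable := by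
  rw [← h.1, mem_kSAT_iff, decCNF_encode]
  exact ⟨fun h' => h'.2, fun h' => ⟨h.2, h'⟩⟩

/-- A string that is not good is not in `kSAT k`. [folklore] -/
theorem not_mem_kSAT_of_not_good {k : ℕ} {x : List Bool} (h : ¬ Good k x) : x ∉ kSAT k :=
  fun hx => h (good_of_mem_kSAT hx)

/-- The good-input test as a one-bit brick: `andFn isCanonFn (widthLEFn k)`. [cite: AroraBarakCC2009, §1.3] -/
def goodFn (k : ℕ) : List Bool → List Bool := andFn isCanonFn (widthLEFn k)

/-- `goodFn k ∈ FP`. [cite: AroraBarakCC2009, §1.3] -/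
theorem goodFn_mem_FP (k : ℕ) : goodFn k ∈ FP := andFn_mem_FP isCanonFn_mem_FP (widthLEFn_mem_FP k)

/-- `goodFn k x = [Good k x]`. [folklore] -/
theorem goodFn_apply (k : ℕ) (x : List Bool) : goodFn k x = [decide (Good k x)] := by
  by_cases hc : encodingCNF.encode (decCNF x) = x
  · have h1 : isCanonFn x = [true] := by rw [isCanonFn_apply]; simp [hc]
    have h2 : widthLEFn k x = [decide (CNF.IsWidthLE k (decCNF x))] := by
      conv_lhs => rw [← hc]
      exact widthLEFn_encode k _
    rw [goodFn, andFn_apply h1 h2]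
    by_cases hw : CNF.IsWidthLE k (decCNF x) <;> simp [Good, hc, hw]
  · have h1 : isCanonFn x = [false] := by rw [isCanonFn_apply]; simp [hc]
    obtain ⟨b, hb⟩ := oneBit_widthLEFn k x
    rw [goodFn, andFn_apply h1 hb]
    simp [Good, hc]

/-- The number of variables handed over: `2 ^ (|x| + 1)` for a good input, `0` otherwise. [folklore] -/
def nvOf (k : ℕ) (x : List Bool) : ℕ := if Good k x then 2 ^ (x.length + 1) else 0

/-- The clauses handed over: the decoded clauses for a good input, none otherwise. [folklore] -/
def clausesOf (k : ℕ) (x : List Bool) : CNF ℕ := if Good k x then decCNF x else []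

/-- **The formula handed to the `Γ'` side**: the decoded `k`-CNF on `2 ^ (|x| + 1)` variables
(every variable a string of length `|x|` denotes is smaller, `Ladder3.decCNF_vars_lt`) for a good
input, and the empty formula on `0` variables otherwise. [folklore] -/
def kcnfOf (k : ℕ) (x : List Bool) : KCNF k where
  numVars := nvOf k x
  clauses := clausesOf k x
  fst_lt_numVars := by
    unfold nvOf clausesOf
    split_ifs with h
    · exact Ladder3.decCNF_vars_lt x
    · simp
  length_le := by
    unfold clausesOf
    split_ifs with h
    · exact h.2
    · simp

/-- The clauses of `kcnfOf` on a good input. [folklore] -/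
theorem kcnfOf_clauses_of_good {k : ℕ} {x : List Bool} (h : Good k x) : (kcnfOf k x).clauses = decCNF x :=
  if_pos h

/-- The number of variables of `kcnfOf` on a good input. [folklore] -/
theorem kcnfOf_numVars_of_good {k : ℕ} {x : List Bool} (h : Good k x) :
    (kcnfOf k x).numVars = 2 ^ (x.length + 1) :=
  if_pos h

/-- The clauses of `kcnfOf` on a bad input. [folklore] -/
theorem kcnfOf_clauses_of_not_good {k : ℕ} {x : List Bool} (h : ¬ Good k x) : (kcnfOf k x).clauses = [] :=
  if_neg h

/-- The number of variables of `kcnfOf` on a bad input. [folklore] -/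
theorem kcnfOf_numVars_of_not_good {k : ℕ} {x : List Bool} (h : ¬ Good k x) : (kcnfOf k x).numVars = 0 :=
  if_neg h

/-! ### The front end -/

/-- The front-end word of a flag, a number of variables and a clause list:
`⟨[g], ⟨⌜n⌝, swapped code of the clauses⟩⟩`. [folklore] -/
def preWord (g : Bool) (n : ℕ) (cs : CNF ℕ) : List Bool :=
  boolPair [g] (boolPair (encodeNat n) (swLit.listBool.listBool.encode cs))

/-- **The front end** `preFn k`: on a good input the flag `1`, the header `⌜2^{|x|+1}⌝` and the
swapped code of the clauses; otherwise the flag `0`, the header `⌜0⌝` and the code of no clauses.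
[cite: AroraBarakCC2009, §1.3 (branching and pairing of polynomial-time maps)] -/
def preFn (k : ℕ) : List Bool → List Bool :=
  iteFn (goodFn k) (fanoutFn (fun _ => [true]) (fanoutFn hdrFn swCodeFn)) fun _ => preWord false 0 []

/-- **`preFn k ∈ FP`.** [cite: AroraBarakCC2009, §1.3] -/
theorem preFn_mem_FP (k : ℕ) : preFn k ∈ FP :=
  iteFn_mem_FP (goodFn_mem_FP k)
    (fanoutFn_mem_FP (const_mem_FP _) (fanoutFn_mem_FP hdrFn_mem_FP swCodeFn_mem_FP)) (const_mem_FP _)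

/-- **Value of the front end**: `preFn k x = preWord [Good k x] (nvOf k x) (clausesOf k x)`, i.e. the
flag, the `numVars` header and the swapped clause code of `kcnfOf k x`. [folklore] -/
theorem preFn_eq (k : ℕ) (x : List Bool) :
    preFn k x = preWord (decide (Good k x)) (kcnfOf k x).numVars (kcnfOf k x).clauses := by
  by_cases h : Good k x
  · rw [preFn, iteFn_apply_true (by rw [goodFn_apply]; simp [h]), fanoutFn_apply, fanoutFn_apply,
      hdrFn_apply, swCodeFn_eq, kcnfOf_numVars_of_good h, kcnfOf_clauses_of_good h, preWord]
    simp [h]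
  · rw [preFn, iteFn_apply_false (by rw [goodFn_apply]; simp [h]), kcnfOf_numVars_of_not_good h,
      kcnfOf_clauses_of_not_good h]
    simp [h]

/-! ### Sizes -/

/-- A literal code is longer than the `Γ'`-literal: `|encodeLiteral l| ≤ |encodingLiteral.encode l|`.
[folklore] -/
theorem length_encodeLiteral_le (l : Literal ℕ) :
    (KCNF.encodeLiteral l).length ≤ (encodingLiteral.encode l).length := by
  rcases l with ⟨v, b⟩
  have h : encodingLiteral.encode (v, b) = boolPair (encodeNat v) [b] := rfl
  rw [h, length_boolPair]
  simp [KCNF.encodeLiteral]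
  omega

/-- A clause code is longer than the `Γ'`-clause: `|encodeClause c| ≤ |encodingClause.encode c|`.
[folklore] -/
theorem length_encodeClause_le (c : Clause ℕ) :
    (KCNF.encodeClause c).length ≤ (encodingClause.encode c).length := by
  have key : ∀ c : Clause ℕ,
      (c.map fun l => (KCNF.encodeLiteral l).length).sum ≤ (frames (c.map encodingLiteral.encode)).length := by
    intro c
    induction c with
    | nil => simp
    | cons l c ih =>
      simp only [List.map_cons, List.sum_cons, frames_cons, List.length_append, Com.length_repBits,
        List.length_cons, List.length_nil]
      have h1 := length_encodeLiteral_le l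
      omega
  have h : encodingClause.encode c = encodingLiteral.listBool.encode c := rfl
  rw [h, listBool_encode_eq]
  simp only [KCNF.encodeClause, List.cons_append, List.length_cons, List.length_append,
    List.length_flatMap, List.length_nil, Com.length_repBits]
  have := key c
  omega

/-- **The `Γ'`-clauses are shorter than the CNF code**: `|φ.flatMap encodeClause| ≤ |encode φ|`.
[folklore] -/
theorem length_flatMap_encodeClause_le (φ : CNF ℕ) :
    (φ.flatMap KCNF.encodeClause).length ≤ (encodingCNF.encode φ).length := by
  have key : ∀ φ : CNF ℕ,
      (φ.map fun c => (KCNF.encodeClause c).length).sum ≤ (frames (φ.map encodingClause.encode)).length := by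
    intro φ
    induction φ with
    | nil => simp
    | cons c φ ih =>
      simp only [List.map_cons, List.sum_cons, frames_cons, List.length_append, Com.length_repBits,
        List.length_cons, List.length_nil]
      have h1 := length_encodeClause_le c
      omega
  have h : encodingCNF.encode φ = encodingClause.listBool.encode φ := rfl
  rw [h, listBool_encode_eq]
  simp only [List.length_append, List.length_flatMap, Com.length_repBits, List.length_cons,
    List.length_nil]
  have := key φ
  omega

/-- The header numeral `⌜2^{|x|+1}⌝` has `|x| + 2` digits. [folklore] -/
theorem length_encodeNat_two_pow (x : List Bool) : (encodeNat (2 ^ (x.length + 1))).length = x.length + 2 := by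
  rw [← hdrFn_apply, hdrFn_eq_replicate]
  simp

/-- **The formula handed over is short**: `|encode (kcnfOf k x)| ≤ 2 |x| + 3`. [folklore] -/
theorem length_encode_kcnfOf_le (k : ℕ) (x : List Bool) : (kcnfOf k x).encode.length ≤ 2 * x.length + 3 := by
  by_cases h : Good k x
  · have h1 := length_flatMap_encodeClause_le (decCNF x)
    rw [h.1] at h1
    simp only [KCNF.encode, kcnfOf_numVars_of_good h, kcnfOf_clauses_of_good h, List.length_append,
      List.length_map, List.length_cons, length_encodeNat_two_pow]
    omega
  · simp [KCNF.encode, kcnfOf_numVars_of_not_good h, kcnfOf_clauses_of_not_good h, encodeNat, encodeNum]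

/-- The front-end word of a bad input is a constant. [folklore] -/
theorem preFn_of_not_good {k : ℕ} {x : List Bool} (h : ¬ Good k x) : preFn k x = preWord false 0 [] := by
  rw [preFn_eq, kcnfOf_numVars_of_not_good h, kcnfOf_clauses_of_not_good h]
  simp [h]

end Literature.Computability.FineGrained.SerfKSat
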